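import Mathlib

/-!
# Supply of same-colour reflection structures (crux `HyperoctahedralThreshold`, refutation line, lead c3)

Three involutions `μ b` on `Fin n` ("colours") act on the right by `x · g := g.foldl (fun v b => μ b v) x`.
A **same-colour reflection structure** of colour `c` and length `m` is a pair `(a, g)` with `g` a reduced word
(`List.IsChain (· ≠ ·) g`) of length `m` whose first and last letters are `≠ c`, such that
`μ c (a · g) = (μ c a) · g` (the `c`-edge at `a` is carried to a `c`-edge); write `Π(m)` for their number.

`sameColourSupply` (crux NOTES §15.1): if every `μ b` is a fixed-point-free involution then
  `(n · 2^k)² ≤ (n² - n) · (n · 2^k + Σ_{i<k} 3^i · Π(2k - 2i))`.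
Proof: let `D` be the `n · 2^k` pairs `(a, g)` with `g` reduced of length `k` and first letter `≠ c`
(`card_redWords`), and `Φ (a, g) := (a · g, (μ c a) · g)`, which is off-diagonal.  Cauchy–Schwarz over the
`n² - n` off-diagonal slots (`card_sq_le_card_mul_card_pairs`) gives `|D|² ≤ (n² - n) · #{(e₁, e₂) : Φ e₁ = Φ e₂}`,
and the pairs with `e₁ ≠ e₂` ("collisions") whose longest common suffix `s` has length `i < k` inject, via
`(e₁, e₂) ↦ (s, (a, h₁ ++ h₂.reverse))` (`gⱼ = hⱼ ++ s`), into `(words of length i) × (structures of length 2k - 2i)`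
(`collision_structure`, `collision_inverse`, `card_collisions_le`).
Pure finite combinatorics under `import Mathlib`; no definitions are introduced (all sets are written out as
`Finset` expressions, in the conventions of the sibling `…RotationIdentity` file).
-/

set_option linter.dupNamespace false

namespace Summit.MatrixMultiplication.MatrixMultiplication.Theorems.HyperoctahedralThreshold.Supply

open Finset

variable {n : ℕ}

/-! ### Word action (conventions of the sibling `...RotationIdentity` file, restated to stay import-free) -/

-- adapted from Summits/.../SnSubsetDichotomyHyperoctahedralThresholdRotationIdentity.lean (same line, p111510)
/-- Walking back along the reversed word undoes the walk (letters are involutions). -/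
theorem foldl_act_reverse (μ : Fin 3 → Equiv.Perm (Fin n)) (hμ : ∀ b, μ b * μ b = 1) :
    ∀ (w : List (Fin 3)) (x : Fin n),
      w.reverse.foldl (fun v b => μ b v) (w.foldl (fun v b => μ b v) x) = x := by
  intro w
  induction w with
  | nil => intro x; rfl
  | cons c w ih =>
    intro x
    rw [List.foldl_cons, List.reverse_cons, List.foldl_append, ih]
    show μ c (μ c x) = x
    have : (μ c * μ c) x = x := by rw [hμ c]; rfl
    simpa using this

/-- The action of a fixed word is injective. -/
theorem foldl_act_injective (μ : Fin 3 → Equiv.Perm (Fin n)) (hμ : ∀ b, μ b * μ b = 1)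
    (w : List (Fin 3)) : Function.Injective (fun x => w.foldl (fun v b => μ b v) x) := by
  intro x y h
  have := congrArg (fun v => w.reverse.foldl (fun v b => μ b v) v) h
  simpa [foldl_act_reverse μ hμ] using this

/-- Membership in the `Finset` of all words of length `m` over a finite alphabet. -/
theorem mem_words {α : Type*} [Fintype α] [DecidableEq α] {m : ℕ} {z : List α} :
    z ∈ (Finset.univ : Finset (List.Vector α m)).image (fun v => v.toList) ↔ z.length = m := by
  constructor
  · intro h
    obtain ⟨v, -, rfl⟩ := Finset.mem_image.1 h
    exact v.toList_length
  · intro h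
    exact Finset.mem_image.2 ⟨⟨z, h⟩, Finset.mem_univ _, rfl⟩

/-! ### Counting words -/

/-- There are `3 ^ m` colour words of length `m`. -/
theorem card_words (m : ℕ) :
    ((Finset.univ : Finset (List.Vector (Fin 3) m)).image (fun v => v.toList)).card = 3 ^ m := by
  rw [Finset.card_image_of_injective _ List.Vector.toList_injective, Finset.card_univ, card_vector,
    Fintype.card_fin]

/-- There are `2 ^ k` reduced colour words of length `k` whose first letter is not `c`. -/
theorem card_redWords (k : ℕ) : ∀ c : Fin 3,
    (((Finset.univ : Finset (List.Vector (Fin 3) k)).image (fun v => v.toList)).filter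
      (fun g => List.IsChain (· ≠ ·) g ∧ g.head? ≠ some c)).card = 2 ^ k := by
  induction k with
  | zero =>
    intro c
    rw [pow_zero, Finset.card_eq_one]
    refine ⟨[], ?_⟩
    ext g
    simp only [Finset.mem_filter, mem_words, Finset.mem_singleton, List.length_eq_zero_iff]
    constructor
    · rintro ⟨rfl, -⟩; rfl
    · rintro rfl; simp
  | succ k ih =>
    intro c
    rw [Finset.card_eq_sum_card_fiberwise (f := fun g : List (Fin 3) => g.head?.getD c)
      (t := (Finset.univ : Finset (Fin 3)).filter (fun b => b ≠ c)) ?maps]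
    case maps =>
      intro g hg
      obtain ⟨hlen, -, hhd⟩ := Finset.mem_filter.1 (Finset.mem_coe.1 hg)
      rw [mem_words] at hlen
      obtain ⟨x, t, rfl⟩ := List.exists_cons_of_length_eq_add_one hlen
      simp only [List.head?_cons, Option.getD_some, Finset.coe_filter, Finset.mem_univ, true_and,
        Set.mem_setOf_eq]
      intro h; exact hhd (by rw [h]; rfl)
    have hfib : ∀ b ∈ (Finset.univ : Finset (Fin 3)).filter (fun b => b ≠ c),
        ((((Finset.univ : Finset (List.Vector (Fin 3) (k + 1))).image (fun v => v.toList)).filter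
          (fun g => List.IsChain (· ≠ ·) g ∧ g.head? ≠ some c)).filter
            (fun g => g.head?.getD c = b)).card = 2 ^ k := by
      intro b hb
      have hbc : b ≠ c := (Finset.mem_filter.1 hb).2
      rw [← ih b]
      refine Finset.card_nbij' (fun g => g.tail) (fun t => b :: t) ?_ ?_ ?_ ?_
      · intro g hg
        obtain ⟨hg1, hg2⟩ := Finset.mem_filter.1 (Finset.mem_coe.1 hg)
        obtain ⟨hlen, hch, -⟩ := Finset.mem_filter.1 hg1
        rw [mem_words] at hlen
        obtain ⟨x, t, rfl⟩ := List.exists_cons_of_length_eq_add_one hlen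
        simp only [List.head?_cons, Option.getD_some] at hg2
        subst hg2
        refine Finset.mem_coe.2 (Finset.mem_filter.2 ⟨mem_words.2 (by simpa using hlen), hch.tail, ?_⟩)
        intro ht
        exact (List.isChain_cons.1 hch).1 x ht rfl
      · intro t ht
        obtain ⟨hlen, hch, hhd⟩ := Finset.mem_filter.1 (Finset.mem_coe.1 ht)
        rw [mem_words] at hlen
        refine Finset.mem_coe.2 (Finset.mem_filter.2 ⟨Finset.mem_filter.2 ⟨mem_words.2 (by simp [hlen]),
          ?_, ?_⟩, by simp⟩)
        · refine List.isChain_cons.2 ⟨?_, hch⟩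
          intro y hy hby
          exact hhd (by rw [hby]; exact (Option.mem_def.1 hy))
        · simpa using hbc
      · intro g hg
        obtain ⟨hg1, hg2⟩ := Finset.mem_filter.1 (Finset.mem_coe.1 hg)
        obtain ⟨hlen, -, -⟩ := Finset.mem_filter.1 hg1
        rw [mem_words] at hlen
        obtain ⟨x, t, rfl⟩ := List.exists_cons_of_length_eq_add_one hlen
        simp only [List.head?_cons, Option.getD_some] at hg2
        subst hg2; rfl
      · intro t _; rfl
    rw [Finset.sum_congr rfl hfib, Finset.sum_const, smul_eq_mul, Finset.filter_ne',
      Finset.card_erase_of_mem (Finset.mem_univ c), Finset.card_univ, Fintype.card_fin, pow_succ]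
    ring

/-! ### Cauchy–Schwarz for the fibres of a map -/

/-- Cauchy–Schwarz for fibres: `|s| ^ 2 ≤ |t| · #{(x, y) ∈ s × s : f x = f y}` when `f` maps `s` into `t`. -/
theorem card_sq_le_card_mul_card_pairs {α β : Type*} [DecidableEq β] (s : Finset α) (t : Finset β)
    (f : α → β) (hf : ∀ x ∈ s, f x ∈ t) :
    s.card ^ 2 ≤ t.card * ((s ×ˢ s).filter (fun q => f q.1 = f q.2)).card := by
  have h1 : s.card = ∑ b ∈ t, (s.filter (fun x => f x = b)).card :=
    Finset.card_eq_sum_card_fiberwise (fun x hx => hf x hx)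
  have h2 : ((s ×ˢ s).filter (fun q => f q.1 = f q.2)).card =
      ∑ b ∈ t, (s.filter (fun x => f x = b)).card ^ 2 := by
    rw [Finset.card_eq_sum_card_fiberwise (f := fun q : α × α => f q.1) (t := t) ?_]
    · refine Finset.sum_congr rfl (fun b _ => ?_)
      rw [sq, ← Finset.card_product]
      congr 1
      ext q
      simp only [Finset.mem_filter, Finset.mem_product]
      constructor
      · rintro ⟨⟨⟨hq1, hq2⟩, hq3⟩, hq4⟩
        exact ⟨⟨hq1, hq4⟩, hq2, hq3.symm.trans hq4⟩
      · rintro ⟨⟨hq1, hq2⟩, hq3, hq4⟩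
        exact ⟨⟨⟨hq1, hq3⟩, hq2.trans hq4.symm⟩, hq2⟩
    · intro q hq
      have hq' := Finset.mem_filter.1 (Finset.mem_coe.1 hq)
      exact Finset.mem_coe.2 (hf q.1 (Finset.mem_product.1 hq'.1).1)
  rw [h2, h1]
  exact sq_sum_le_card_mul_sum_sq

/-! ### The reflection structure of a colliding pair -/

/-- From a colliding pair `(a, g₁)`, `(a', g₂)` (same endpoints `a·g₁ = a'·g₂`, `(c a)·g₁ = (c a')·g₂`) whose
longest common suffix has length `i < k`, the word `g' := h₁ ++ h₂⁻¹` (`gⱼ = hⱼ ++ s`, `|s| = i`) is a reduced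
word of length `2k - 2i` with first and last letter `≠ c` carrying `a ↦ a'` and `c a ↦ c a'`. -/
theorem collision_structure (μ : Fin 3 → Equiv.Perm (Fin n)) (hμ : ∀ b, μ b * μ b = 1) (c : Fin 3)
    {k i : ℕ} (hi : i < k) {a a' : Fin n} {g₁ g₂ : List (Fin 3)}
    (hl₁ : g₁.length = k) (hl₂ : g₂.length = k)
    (hc₁ : List.IsChain (· ≠ ·) g₁) (hc₂ : List.IsChain (· ≠ ·) g₂)
    (hh₁ : g₁.head? ≠ some c) (hh₂ : g₂.head? ≠ some c)
    (he₁ : g₁.foldl (fun v b => μ b v) a = g₂.foldl (fun v b => μ b v) a')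
    (he₂ : g₁.foldl (fun v b => μ b v) (μ c a) = g₂.foldl (fun v b => μ b v) (μ c a'))
    (hs : g₁.drop (k - i) = g₂.drop (k - i))
    (hns : g₁.drop (k - (i + 1)) ≠ g₂.drop (k - (i + 1))) :
    (g₁.take (k - i) ++ (g₂.take (k - i)).reverse).length = 2 * k - 2 * i ∧
    List.IsChain (· ≠ ·) (g₁.take (k - i) ++ (g₂.take (k - i)).reverse) ∧
    (g₁.take (k - i) ++ (g₂.take (k - i)).reverse).head? ≠ some c ∧
    (g₁.take (k - i) ++ (g₂.take (k - i)).reverse).getLast? ≠ some c ∧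
    (g₁.take (k - i) ++ (g₂.take (k - i)).reverse).foldl (fun v b => μ b v) a = a' ∧
    (g₁.take (k - i) ++ (g₂.take (k - i)).reverse).foldl (fun v b => μ b v) (μ c a) = μ c a' := by
  set h₁ := g₁.take (k - i) with hh1def
  set h₂ := g₂.take (k - i) with hh2def
  set s := g₁.drop (k - i) with hsdef
  have hg₁ : g₁ = h₁ ++ s := (List.take_append_drop (k - i) g₁).symm
  have hg₂ : g₂ = h₂ ++ s := by rw [hs]; exact (List.take_append_drop (k - i) g₂).symm
  have hlh₁ : h₁.length = k - i := by rw [List.length_take]; omega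
  have hlh₂ : h₂.length = k - i := by rw [List.length_take]; omega
  have hne₁ : h₁ ≠ [] := List.ne_nil_of_length_pos (by omega)
  have hne₂ : h₂ ≠ [] := List.ne_nil_of_length_pos (by omega)
  -- cancel the common suffix `s`
  have hca : h₁.foldl (fun v b => μ b v) a = h₂.foldl (fun v b => μ b v) a' := by
    rw [hg₁, hg₂, List.foldl_append, List.foldl_append] at he₁
    exact foldl_act_injective μ hμ s he₁
  have hcb : h₁.foldl (fun v b => μ b v) (μ c a) = h₂.foldl (fun v b => μ b v) (μ c a') := by
    rw [hg₁, hg₂, List.foldl_append, List.foldl_append] at he₂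
    exact foldl_act_injective μ hμ s he₂
  refine ⟨?_, ?_, ?_, ?_, ?_, ?_⟩
  · rw [List.length_append, List.length_reverse, hlh₁, hlh₂]; omega
  · refine List.IsChain.append (hc₁.take _) ?_ ?_
    · rw [List.isChain_reverse]
      exact (hc₂.take _).imp (fun x y hxy => Ne.symm hxy)
    · intro x hx y hy hxy
      rw [List.head?_reverse] at hy
      subst hxy
      apply hns
      have e₁ : g₁ = h₁.dropLast ++ ([x] ++ s) := by
        rw [← List.append_assoc, List.dropLast_append_getLast? x hx]; exact hg₁
      have e₂ : g₂ = h₂.dropLast ++ ([x] ++ s) := by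
        rw [← List.append_assoc, List.dropLast_append_getLast? x hy]; exact hg₂
      have d₁ : g₁.drop (k - (i + 1)) = [x] ++ s := by
        rw [e₁]; exact List.drop_left' (by rw [List.length_dropLast, hlh₁]; omega)
      have d₂ : g₂.drop (k - (i + 1)) = [x] ++ s := by
        rw [e₂]; exact List.drop_left' (by rw [List.length_dropLast, hlh₂]; omega)
      rw [d₁, d₂]
  · rw [List.head?_append_of_ne_nil _ hne₁, hh1def, List.head?_take, if_neg (by omega)]
    exact hh₁
  · rw [List.getLast?_append_of_ne_nil _ (by simpa using hne₂), List.getLast?_reverse, hh2def,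
      List.head?_take, if_neg (by omega)]
    exact hh₂
  · rw [List.foldl_append, hca, foldl_act_reverse μ hμ]
  · rw [List.foldl_append, hcb, foldl_act_reverse μ hμ]

/-- The colliding pair is recovered from its reflection structure and the common suffix. -/
theorem collision_inverse {k i : ℕ} (hi : i ≤ k) {g₁ g₂ : List (Fin 3)}
    (hl₁ : g₁.length = k) (hl₂ : g₂.length = k) (hs : g₁.drop (k - i) = g₂.drop (k - i)) :
    (g₁.take (k - i) ++ (g₂.take (k - i)).reverse).take (k - i) ++ g₁.drop (k - i) = g₁ ∧
    ((g₁.take (k - i) ++ (g₂.take (k - i)).reverse).drop (k - i)).reverse ++ g₁.drop (k - i) = g₂ := by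
  have hlh₁ : (g₁.take (k - i)).length = k - i := by rw [List.length_take]; omega
  constructor
  · rw [List.take_left' hlh₁]; exact List.take_append_drop _ _
  · rw [List.drop_left' hlh₁, List.reverse_reverse, hs]; exact List.take_append_drop _ _

/-- Discrete intermediate value: a predicate true at `0` and false at `k` steps down somewhere below `k`. -/
theorem exists_step {P : ℕ → Prop} : ∀ k : ℕ, P 0 → ¬ P k → ∃ i < k, P i ∧ ¬ P (i + 1)
  | 0, h0, hk => absurd h0 hk
  | k + 1, h0, hk => by
    by_cases h : P k
    · exact ⟨k, Nat.lt_succ_self k, h, hk⟩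
    · obtain ⟨i, hi, hP⟩ := exists_step k h0 h
      exact ⟨i, Nat.lt_succ_of_lt hi, hP⟩

/-! ### Counting collisions -/

/-- Collisions with longest common suffix of length exactly `i < k` inject into
`(words of length i) × (reflection structures of length 2k - 2i)`. -/
theorem card_collisions_le (μ : Fin 3 → Equiv.Perm (Fin n)) (hμ : ∀ b, μ b * μ b = 1) (c : Fin 3)
    (k i : ℕ) (hi : i < k) :
    (((((Finset.univ : Finset (Fin n)) ×ˢ
        (((Finset.univ : Finset (List.Vector (Fin 3) k)).image (fun v => v.toList)).filter
          (fun g => List.IsChain (· ≠ ·) g ∧ g.head? ≠ some c))) ×ˢ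
       ((Finset.univ : Finset (Fin n)) ×ˢ
        (((Finset.univ : Finset (List.Vector (Fin 3) k)).image (fun v => v.toList)).filter
          (fun g => List.IsChain (· ≠ ·) g ∧ g.head? ≠ some c)))).filter
      (fun q => q.1 ≠ q.2 ∧
        q.1.2.foldl (fun v b => μ b v) q.1.1 = q.2.2.foldl (fun v b => μ b v) q.2.1 ∧
        q.1.2.foldl (fun v b => μ b v) (μ c q.1.1) = q.2.2.foldl (fun v b => μ b v) (μ c q.2.1))).filter
      (fun q => q.1.2.drop (k - i) = q.2.2.drop (k - i) ∧
        q.1.2.drop (k - (i + 1)) ≠ q.2.2.drop (k - (i + 1)))).card ≤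
    3 ^ i * (((Finset.univ : Finset (Fin n)) ×ˢ
      (((Finset.univ : Finset (List.Vector (Fin 3) (2 * k - 2 * i))).image (fun v => v.toList)).filter
        (fun g => List.IsChain (· ≠ ·) g ∧ g.head? ≠ some c ∧ g.getLast? ≠ some c))).filter
      (fun p => μ c (p.2.foldl (fun v b => μ b v) p.1) = p.2.foldl (fun v b => μ b v) (μ c p.1))).card := by
  rw [← card_words i, ← Finset.card_product]
  refine Finset.card_le_card_of_injOn
    (fun q => (q.1.2.drop (k - i), (q.1.1, q.1.2.take (k - i) ++ (q.2.2.take (k - i)).reverse))) ?_ ?_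
  · intro q hq
    rw [Finset.mem_coe, Finset.mem_filter, Finset.mem_filter, Finset.mem_product, Finset.mem_product,
      Finset.mem_product] at hq
    obtain ⟨⟨⟨⟨-, hg₁⟩, -, hg₂⟩, -, he₁, he₂⟩, hs, hns⟩ := hq
    rw [Finset.mem_filter, mem_words] at hg₁ hg₂
    obtain ⟨hl₁, hc₁, hh₁⟩ := hg₁
    obtain ⟨hl₂, hc₂, hh₂⟩ := hg₂
    obtain ⟨H1, H2, H3, H4, H5, H6⟩ :=
      collision_structure μ hμ c hi hl₁ hl₂ hc₁ hc₂ hh₁ hh₂ he₁ he₂ hs hns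
    rw [Finset.mem_coe, Finset.mem_product]
    refine ⟨mem_words.2 (by rw [List.length_drop, hl₁]; omega), ?_⟩
    rw [Finset.mem_filter, Finset.mem_product, Finset.mem_filter, mem_words]
    refine ⟨⟨Finset.mem_univ _, H1, H2, H3, H4⟩, ?_⟩
    dsimp only
    rw [H5, H6]
  · refine Set.LeftInvOn.injOn (f₁' := fun r => ((r.2.1, r.2.2.take (k - i) ++ r.1),
      (r.2.2.foldl (fun v b => μ b v) r.2.1, (r.2.2.drop (k - i)).reverse ++ r.1))) ?_
    intro q hq
    rw [Finset.mem_coe, Finset.mem_filter, Finset.mem_filter, Finset.mem_product, Finset.mem_product,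
      Finset.mem_product] at hq
    obtain ⟨⟨⟨⟨-, hg₁⟩, -, hg₂⟩, -, he₁, he₂⟩, hs, hns⟩ := hq
    rw [Finset.mem_filter, mem_words] at hg₁ hg₂
    obtain ⟨hl₁, hc₁, hh₁⟩ := hg₁
    obtain ⟨hl₂, hc₂, hh₂⟩ := hg₂
    obtain ⟨-, -, -, -, H5, -⟩ :=
      collision_structure μ hμ c hi hl₁ hl₂ hc₁ hc₂ hh₁ hh₂ he₁ he₂ hs hns
    obtain ⟨E1, E2⟩ := collision_inverse hi.le hl₁ hl₂ hs
    dsimp only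
    rw [E1, E2, H5]

/-! ### The supply inequality -/

/-- **Supply of same-colour reflection structures** (crux NOTES §15.1).  With `D` the `n · 2^k` pairs
`(a, g)` (`g` reduced of length `k`, first letter `≠ c`) and `Φ (a, g) := (a·g, (c a)·g)` (off-diagonal, as
`μ c` is fixed-point free and words act injectively), Cauchy–Schwarz gives `|D|² ≤ (n² - n) · (|D| + #collisions)`,
and a collision with longest common suffix of length `i` is recovered from the suffix (`3^i` choices) and a
same-colour reflection structure of length `2k - 2i` (`card_collisions_le`). -/
theorem sameColourSupply (n k : ℕ) (μ : Fin 3 → Equiv.Perm (Fin n)) (c : Fin 3)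
    (hμ : ∀ b, μ b * μ b = 1) (hfix : ∀ b v, μ b v ≠ v) :
    (n * 2 ^ k) ^ 2 ≤ (n * n - n) * (n * 2 ^ k + ∑ i ∈ Finset.range k, 3 ^ i *
      (((Finset.univ : Finset (Fin n)) ×ˢ
        (((Finset.univ : Finset (List.Vector (Fin 3) (2 * k - 2 * i))).image (fun v => v.toList)).filter
          (fun g => List.IsChain (· ≠ ·) g ∧ g.head? ≠ some c ∧ g.getLast? ≠ some c))).filter
        (fun p => μ c (p.2.foldl (fun v b => μ b v) p.1) = p.2.foldl (fun v b => μ b v) (μ c p.1))).card) := by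
  -- the domain `D` of the endpoint map
  set D := (Finset.univ : Finset (Fin n)) ×ˢ
    (((Finset.univ : Finset (List.Vector (Fin 3) k)).image (fun v => v.toList)).filter
      (fun g => List.IsChain (· ≠ ·) g ∧ g.head? ≠ some c)) with hD
  have hDcard : D.card = n * 2 ^ k := by
    rw [hD, Finset.card_product, Finset.card_univ, Fintype.card_fin, card_redWords k c]
  -- the endpoint map `Φ (a, g) = (a·g, (c a)·g)` lands off the diagonal
  set Φ : Fin n × List (Fin 3) → Fin n × Fin n :=
    fun p => (p.2.foldl (fun v b => μ b v) p.1, p.2.foldl (fun v b => μ b v) (μ c p.1)) with hΦ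
  have hmaps : ∀ p ∈ D, Φ p ∈ (Finset.univ : Finset (Fin n)).offDiag := by
    intro p _
    rw [Finset.mem_offDiag]
    refine ⟨Finset.mem_univ _, Finset.mem_univ _, ?_⟩
    intro h
    exact hfix c p.1 (foldl_act_injective μ hμ p.2 h).symm
  have hCS := card_sq_le_card_mul_card_pairs D (Finset.univ : Finset (Fin n)).offDiag Φ hmaps
  rw [Finset.offDiag_card, Finset.card_univ, Fintype.card_fin, hDcard] at hCS
  refine hCS.trans (Nat.mul_le_mul_left _ ?_)
  -- pairs with equal endpoints are diagonal or collisions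
  set C := (D ×ˢ D).filter (fun q => q.1 ≠ q.2 ∧
    q.1.2.foldl (fun v b => μ b v) q.1.1 = q.2.2.foldl (fun v b => μ b v) q.2.1 ∧
    q.1.2.foldl (fun v b => μ b v) (μ c q.1.1) = q.2.2.foldl (fun v b => μ b v) (μ c q.2.1)) with hC
  have hF : (D ×ˢ D).filter (fun q => Φ q.1 = Φ q.2) ⊆ D.diag ∪ C := by
    intro q hq
    rw [Finset.mem_filter] at hq
    rw [Finset.mem_union, Finset.mem_diag]
    by_cases h : q.1 = q.2
    · exact Or.inl ⟨(Finset.mem_product.1 hq.1).1, h⟩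
    · exact Or.inr (Finset.mem_filter.2 ⟨hq.1, h, congrArg Prod.fst hq.2, congrArg Prod.snd hq.2⟩)
  have hFcard : ((D ×ˢ D).filter (fun q => Φ q.1 = Φ q.2)).card ≤ n * 2 ^ k + C.card := by
    refine (Finset.card_le_card hF).trans ((Finset.card_union_le _ _).trans ?_)
    rw [Finset.diag_card, hDcard]
  refine hFcard.trans (Nat.add_le_add_left ?_ _)
  -- collisions, sorted by the length `i < k` of the longest common suffix
  have hcover : C ⊆ (Finset.range k).biUnion (fun i => C.filter (fun q =>
      q.1.2.drop (k - i) = q.2.2.drop (k - i) ∧ q.1.2.drop (k - (i + 1)) ≠ q.2.2.drop (k - (i + 1)))) := by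
    intro q hq
    have hq' := hq
    rw [hC, Finset.mem_filter, Finset.mem_product, hD, Finset.mem_product, Finset.mem_product] at hq'
    obtain ⟨⟨⟨-, hg₁⟩, -, hg₂⟩, hne, he₁, -⟩ := hq'
    rw [Finset.mem_filter, mem_words] at hg₁ hg₂
    obtain ⟨i, hik, hPi, hnP⟩ := exists_step (P := fun j => q.1.2.drop (k - j) = q.2.2.drop (k - j)) k
      (by
        rw [Nat.sub_zero, List.drop_of_length_le (by rw [hg₁.1]), List.drop_of_length_le (by rw [hg₂.1])])
      (by
        rw [Nat.sub_self, List.drop_zero, List.drop_zero]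
        intro hg
        apply hne
        have he := he₁
        rw [hg] at he
        exact Prod.ext (foldl_act_injective μ hμ q.2.2 he) hg)
    exact Finset.mem_biUnion.2 ⟨i, Finset.mem_range.2 hik, Finset.mem_filter.2 ⟨hq, hPi, hnP⟩⟩
  refine (Finset.card_le_card hcover).trans (Finset.card_biUnion_le.trans ?_)
  refine Finset.sum_le_sum (fun i hi => ?_)
  exact card_collisions_le μ hμ c k i (Finset.mem_range.1 hi)

/-- **Registered form** (`stub_sameColourSupply`, a `--supports` sub-goal of crux
`stmt-MatrixMultiplication-10883`): the supply inequality `sameColourSupply`, fully quantified. -/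
theorem stub_sameColourSupply : ∀ (n k : ℕ) (μ : Fin 3 → Equiv.Perm (Fin n)) (c : Fin 3), (∀ b, μ b * μ b = 1) → (∀ b v, μ b v ≠ v) → (n * 2 ^ k) ^ 2 ≤ (n * n - n) * (n * 2 ^ k + ∑ i ∈ Finset.range k, 3 ^ i * (((Finset.univ : Finset (Fin n)) ×ˢ (((Finset.univ : Finset (List.Vector (Fin 3) (2 * k - 2 * i))).image (fun v => v.toList)).filter (fun g => List.IsChain (· ≠ ·) g ∧ g.head? ≠ some c ∧ g.getLast? ≠ some c))).filter (fun p => μ c (p.2.foldl (fun v b => μ b v) p.1) = p.2.foldl (fun v b => μ b v) (μ c p.1))).card) :=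
  fun n k μ c hμ hfix => sameColourSupply n k μ c hμ hfix

end Summit.MatrixMultiplication.MatrixMultiplication.Theorems.HyperoctahedralThreshold.Supply
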